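import Summits.CriticalPhenomena.PercolationContinuityZ3.Theorems.PercNearOneGluingNoHeavyLowerTailCubicThreePointSections
import Summits.CriticalPhenomena.PercolationContinuityZ3.Theorems.PercNearOneGluingNoHeavyLowerTailCubicThreePointGluing
import Summits.CriticalPhenomena.PercolationContinuityZ3.Theorems.PercNearOneGluingNoHeavyLowerTailSahiE3BlockTransfer
import Mathlib.Tactic.Ring
import Mathlib.Tactic.Linarith
import HarnessLib

/-!
# `NoHeavyLowerTail` (stmt-CriticalPhenomena-4575) — decoupling across a vertex separator, part 2a:
# glued configurations in the weighted calculus — bookkeeping (cells sum to one, chord pieces, summation over two independent pieces)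

Support file (prover prim-sahi-p2, SAHI cell P2; `--supports stmt-CriticalPhenomena-4575`).  No definitions, no named facts, no sorries.
Finitary weighted calculus of `…CubicThreePointSections` (prim-ineq-prove-2): random open edges `S ⊆ D` with weights `p`, forced edges `K`,
reachability `R K S`, the five cells `evQ, evU₁ (ab|c), evU₂ (ac|b), evU₃ (bc|a), evT` and their masses `PrW D p (ev… K a b c)`; part 1
(`…CubicThreePointGluing`) supplies the deterministic decomposition of connections across a vertex separator.

A configuration of TWO INDEPENDENT PIECES `(D₁, K₁)`, `(D₂, K₂)` (`D₁ ∩ D₂ = ∅`) is `S₁ ∪ S₂`, `Sᵢ ⊆ Dᵢ`, with weight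
`wtW D₁ S₁ · wtW D₂ S₂` (`ED_union` of `…SahiE3BlockTransfer`).  Contents:
* `R_union_iff` — the open-plus-forced graph of `S₁ ∪ S₂` with forced `K₁ ∪ K₂` is the sup of the two piece graphs; `adj_mem_edge`,
  `not_adj_of_avoids`, `eq_of_R_of_avoids` (a vertex on no edge of a piece is joined only to itself), `R_union_of_left/right` (monotonicity);
* `PrW_eq_ED`, `ED_const'`, `PrW_of_ind_add5`, `ind_cells_sum_one`, **`PrW_cells_sum_one`** (the five cells are a probability vector);
* `PrW_chord_U₂/U₃/T/Q` — a piece none of whose edges contains `c` (`a, b ≠ c`) has law `(1 − x, x, 0, 0, 0)`, `x = P(a ↔ b)`;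
* `PrW_union_of_pointwise_mul`, `PrW_union_of_pointwise_mul3` — summing pointwise product identities over the glued cube.
Parts 2b/2c (`…GluingJoinCells`, `…GluingPendantCells`) compute the five cells of a terminal gluing (JOIN) and of a cut-vertex gluing (PENDANT).
[cite: Grimmett1999, §2.2 (product measure: independence of disjoint edge sets)]
-/

noncomputable section

namespace Summit.CriticalPhenomena.PercolationContinuityZ3.Theorems

namespace TerminalGluing

open Finset SimpleGraph Literature.Probability.Percolation Literature.Probability.Percolation.DecisionTree CubicThreePointStep

variable {V : Type*} [DecidableEq V]

/-! ### Glued configurations: reachability in `(S₁ ∪ S₂) ∪ (K₁ ∪ K₂)` is reachability in the sup of the two piece graphs -/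

/-- The open-plus-forced graph of the glued configuration is the sup of the two piece graphs. [folklore] -/
theorem R_union_iff (K₁ K₂ S₁ S₂ : Finset (Sym2 V)) (x y : V) :
    R (K₁ ∪ K₂) (S₁ ∪ S₂) x y ↔
      (fromEdgeSet (↑(S₁ ∪ K₁) : Set (Sym2 V)) ⊔ fromEdgeSet (↑(S₂ ∪ K₂) : Set (Sym2 V))).Reachable x y := by
  unfold R
  rw [Finset.union_union_union_comm, Finset.coe_union, fromEdgeSet_union]

/-- An adjacency of a piece graph comes from an edge of `D ∪ K` containing both endpoints. [folklore] -/
theorem adj_mem_edge {K S D : Finset (Sym2 V)} (hS : S ⊆ D) {v u : V}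
    (h : (fromEdgeSet (↑(S ∪ K) : Set (Sym2 V))).Adj v u) : ∃ e ∈ D ∪ K, v ∈ e ∧ u ∈ e := by
  rw [fromEdgeSet_adj] at h
  obtain ⟨he, _⟩ := h
  rw [Finset.mem_coe, Finset.mem_union] at he
  refine ⟨s(v, u), ?_, Sym2.mem_mk_left v u, Sym2.mem_mk_right v u⟩
  rw [Finset.mem_union]
  exact he.imp (fun h => hS h) id

/-- A vertex lying on no edge of `D ∪ K` has no neighbour in the piece graph. [folklore] -/
theorem not_adj_of_avoids {K S D : Finset (Sym2 V)} (hS : S ⊆ D) {a : V} (ha : ∀ e ∈ D ∪ K, a ∉ e) (u : V) :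
    ¬ (fromEdgeSet (↑(S ∪ K) : Set (Sym2 V))).Adj a u := fun h => by
  obtain ⟨e, he, hae, _⟩ := adj_mem_edge hS h
  exact ha e he hae

/-- A vertex lying on no edge of `D ∪ K` is joined only to itself. [folklore] -/
theorem eq_of_R_of_avoids {K S D : Finset (Sym2 V)} (hS : S ⊆ D) {a y : V} (ha : ∀ e ∈ D ∪ K, a ∉ e) (h : R K S a y) :
    a = y :=
  eq_of_reachable_of_isolated (not_adj_of_avoids hS ha) h

/-- Monotonicity: a connection inside piece 1 is a connection of the glued configuration. [folklore] -/
theorem R_union_of_left {K₁ K₂ S₁ S₂ : Finset (Sym2 V)} {x y : V} (h : R K₁ S₁ x y) : R (K₁ ∪ K₂) (S₁ ∪ S₂) x y :=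
  (R_union_iff K₁ K₂ S₁ S₂ x y).2 (reachable_sup_of_side (Or.inl h))

/-- Monotonicity: a connection inside piece 2 is a connection of the glued configuration. [folklore] -/
theorem R_union_of_right {K₁ K₂ S₁ S₂ : Finset (Sym2 V)} {x y : V} (h : R K₂ S₂ x y) : R (K₁ ∪ K₂) (S₁ ∪ S₂) x y :=
  (R_union_iff K₁ K₂ S₁ S₂ x y).2 (reachable_sup_of_side (Or.inr h))

/-! ### Bookkeeping for masses -/

section Masses

variable (D : Finset (Sym2 V)) (p : Sym2 V → ℝ)

/-- `PrW` is the cube expectation of the indicator. [folklore] -/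
theorem PrW_eq_ED (X : Set (Finset (Sym2 V))) : PrW D p X = ED D p (ind X) := by
  rw [PrW_eq_sum_ind]; rfl

/-- The cube expectation of a constant. [folklore] -/
theorem ED_const' (c : ℝ) : ED D p (fun _ => c) = c := by
  have h1 : ED D p (fun _ => c) = ED D p (fun S => c * ind (Set.univ : Set (Finset (Sym2 V))) S) :=
    ED_congr_sub D p fun S _ => by rw [ind_of_mem (Set.mem_univ S), mul_one]
  rw [h1, ED_mul_left, ← PrW_eq_ED, PrW_univ, mul_one]

/-- Additivity of `PrW` from a pointwise indicator identity (five pieces). [folklore] -/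
theorem PrW_of_ind_add5 {A B C E G H : Set (Finset (Sym2 V))}
    (h : ∀ S, S ⊆ D → ind A S = ind B S + ind C S + ind E S + ind G S + ind H S) :
    PrW D p A = PrW D p B + PrW D p C + PrW D p E + PrW D p G + PrW D p H := by
  rw [PrW_eq_sum_ind, PrW_eq_sum_ind, PrW_eq_sum_ind, PrW_eq_sum_ind, PrW_eq_sum_ind, PrW_eq_sum_ind,
    ← Finset.sum_add_distrib, ← Finset.sum_add_distrib, ← Finset.sum_add_distrib, ← Finset.sum_add_distrib]
  exact Finset.sum_congr rfl fun S hS => by rw [h S (Finset.mem_powerset.1 hS)]; ring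

variable (K : Finset (Sym2 V)) (a b c : V)

/-- Pointwise: every configuration lies in exactly one of the five cells. [folklore] -/
theorem ind_cells_sum_one (S : Finset (Sym2 V)) :
    ind (evQ K a b c) S + ind (evU₁ K a b c) S + ind (evU₂ K a b c) S + ind (evU₃ K a b c) S + ind (evT K a b c) S = 1 := by
  by_cases hab : R K S a b
  · by_cases hac : R K S a c
    · rw [ind_of_not_mem (fun h : S ∈ evQ K a b c => h.1 hab), ind_of_not_mem (fun h : S ∈ evU₁ K a b c => h.2 hac),
        ind_of_not_mem (fun h : S ∈ evU₂ K a b c => h.2 hab), ind_of_not_mem (fun h : S ∈ evU₃ K a b c => h.2 hab),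
        ind_of_mem (show S ∈ evT K a b c from ⟨hab, hac⟩)]
      ring
    · have hbc : ¬ R K S b c := fun h => hac (hab.trans h)
      rw [ind_of_not_mem (fun h : S ∈ evQ K a b c => h.1 hab), ind_of_mem (show S ∈ evU₁ K a b c from ⟨hab, hac⟩),
        ind_of_not_mem (fun h : S ∈ evU₂ K a b c => h.2 hab), ind_of_not_mem (fun h : S ∈ evU₃ K a b c => hbc h.1),
        ind_of_not_mem (fun h : S ∈ evT K a b c => hac h.2)]
      ring
  · by_cases hac : R K S a c
    · have hbc : ¬ R K S b c := fun h => hab (hac.trans h.symm)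
      rw [ind_of_not_mem (fun h : S ∈ evQ K a b c => h.2.1 hac), ind_of_not_mem (fun h : S ∈ evU₁ K a b c => hab h.1),
        ind_of_mem (show S ∈ evU₂ K a b c from ⟨hac, hab⟩), ind_of_not_mem (fun h : S ∈ evU₃ K a b c => hbc h.1),
        ind_of_not_mem (fun h : S ∈ evT K a b c => hab h.1)]
      ring
    · by_cases hbc : R K S b c
      · rw [ind_of_not_mem (fun h : S ∈ evQ K a b c => h.2.2 hbc), ind_of_not_mem (fun h : S ∈ evU₁ K a b c => hab h.1),
          ind_of_not_mem (fun h : S ∈ evU₂ K a b c => hac h.1), ind_of_mem (show S ∈ evU₃ K a b c from ⟨hbc, hab⟩),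
          ind_of_not_mem (fun h : S ∈ evT K a b c => hab h.1)]
        ring
      · rw [ind_of_mem (show S ∈ evQ K a b c from ⟨hab, hac, hbc⟩), ind_of_not_mem (fun h : S ∈ evU₁ K a b c => hab h.1),
          ind_of_not_mem (fun h : S ∈ evU₂ K a b c => hac h.1), ind_of_not_mem (fun h : S ∈ evU₃ K a b c => hbc h.1),
          ind_of_not_mem (fun h : S ∈ evT K a b c => hab h.1)]
        ring

/-- **The five cells are a probability vector**: `q + u₁ + u₂ + u₃ + t = 1`. [folklore] -/
theorem PrW_cells_sum_one :
    PrW D p (evQ K a b c) + PrW D p (evU₁ K a b c) + PrW D p (evU₂ K a b c) + PrW D p (evU₃ K a b c) +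
      PrW D p (evT K a b c) = 1 := by
  rw [← PrW_univ D p]
  exact (PrW_of_ind_add5 D p (fun S _ => by rw [ind_of_mem (Set.mem_univ S), ind_cells_sum_one K a b c S])).symm

end Masses

/-- Product of indicators vanishes unless both events hold. [folklore] -/
theorem ind_mul_eq_zero_of_not_and {α β : Type*} {A : Set α} {B : Set β} {x : α} {y : β} (h : ¬ (x ∈ A ∧ y ∈ B)) :
    ind A x * ind B y = 0 := by
  by_cases hx : x ∈ A
  · rw [ind_of_not_mem (fun hy => h ⟨hx, hy⟩), mul_zero]
  · rw [ind_of_not_mem hx, zero_mul]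

/-! ### A piece avoiding the terminal `c`: the chord law `(1 − x, x, 0, 0, 0)` -/

section Chord

variable (D : Finset (Sym2 V)) (p : Sym2 V → ℝ) {K : Finset (Sym2 V)} {a b c : V}

/-- With `c` on no edge and `a ≠ c`: the cell `ac|b` is empty. [folklore] -/
theorem PrW_chord_U₂ (hc : ∀ e ∈ D ∪ K, c ∉ e) (hac : a ≠ c) : PrW D p (evU₂ K a b c) = 0 :=
  PrW_eq_zero_of_forall D p fun _ hS h => hac (eq_of_R_of_avoids hS hc h.1.symm).symm

/-- With `c` on no edge and `b ≠ c`: the cell `bc|a` is empty. [folklore] -/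
theorem PrW_chord_U₃ (hc : ∀ e ∈ D ∪ K, c ∉ e) (hbc : b ≠ c) : PrW D p (evU₃ K a b c) = 0 :=
  PrW_eq_zero_of_forall D p fun _ hS h => hbc (eq_of_R_of_avoids hS hc h.1.symm).symm

/-- With `c` on no edge and `a ≠ c`: the cell `abc` is empty. [folklore] -/
theorem PrW_chord_T (hc : ∀ e ∈ D ∪ K, c ∉ e) (hac : a ≠ c) : PrW D p (evT K a b c) = 0 :=
  PrW_eq_zero_of_forall D p fun _ hS h => hac (eq_of_R_of_avoids hS hc h.2.symm).symm

/-- With `c` on no edge (`a, b ≠ c`): `q = 1 − u₁` — the piece is a two-terminal `a–b` network, law `(1 − x, x, 0, 0, 0)`. [folklore] -/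
theorem PrW_chord_Q (hc : ∀ e ∈ D ∪ K, c ∉ e) (hac : a ≠ c) (hbc : b ≠ c) :
    PrW D p (evQ K a b c) = 1 - PrW D p (evU₁ K a b c) := by
  have h := PrW_cells_sum_one D p K a b c
  rw [PrW_chord_U₂ D p hc hac, PrW_chord_U₃ D p hc hbc, PrW_chord_T D p hc hac] at h
  linarith

end Chord

/-! ### Summation over the glued cube (two independent pieces) -/

section Summation

variable {D₁ D₂ : Finset (Sym2 V)} (p : Sym2 V → ℝ) (hD : Disjoint D₁ D₂)
include hD

/-- Summing a pointwise product identity over the glued cube. [folklore] -/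
theorem PrW_union_of_pointwise_mul {X : Set (Finset (Sym2 V))} {A B : Set (Finset (Sym2 V))}
    (h : ∀ S₁ S₂, S₁ ⊆ D₁ → S₂ ⊆ D₂ → ind X (S₁ ∪ S₂) = ind A S₁ * ind B S₂) :
    PrW (D₁ ∪ D₂) p X = PrW D₁ p A * PrW D₂ p B := by
  rw [PrW_eq_ED, ED_union D₁ D₂ hD, PrW_eq_ED, PrW_eq_ED]
  have h1 : ED D₁ p (fun s => ED D₂ p fun T => ind X (s ∪ T)) = ED D₁ p (fun s => ED D₂ p (ind B) * ind A s) := by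
    refine ED_congr_sub D₁ p fun S₁ hS₁ => ?_
    rw [ED_congr_sub D₂ p (fun S₂ hS₂ => h S₁ S₂ hS₁ hS₂)]
    rw [show (fun S₂ => ind A S₁ * ind B S₂) = fun S₂ => ind A S₁ * ind B S₂ from rfl, ED_mul_left, mul_comm]
  rw [h1, ED_mul_left, mul_comm]

/-- Summing a pointwise three-product identity over the glued cube. [folklore] -/
theorem PrW_union_of_pointwise_mul3 {X : Set (Finset (Sym2 V))} {A B A' B' A'' B'' : Set (Finset (Sym2 V))}
    (h : ∀ S₁ S₂, S₁ ⊆ D₁ → S₂ ⊆ D₂ →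
      ind X (S₁ ∪ S₂) = ind A S₁ * ind B S₂ + ind A' S₁ * ind B' S₂ + ind A'' S₁ * ind B'' S₂) :
    PrW (D₁ ∪ D₂) p X = PrW D₁ p A * PrW D₂ p B + PrW D₁ p A' * PrW D₂ p B' + PrW D₁ p A'' * PrW D₂ p B'' := by
  rw [PrW_eq_ED, ED_union D₁ D₂ hD, PrW_eq_ED, PrW_eq_ED, PrW_eq_ED, PrW_eq_ED, PrW_eq_ED, PrW_eq_ED]
  have h1 : ED D₁ p (fun s => ED D₂ p fun T => ind X (s ∪ T)) =
      ED D₁ p (fun s => ED D₂ p (ind B) * ind A s + (ED D₂ p (ind B') * ind A' s + ED D₂ p (ind B'') * ind A'' s)) := by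
    refine ED_congr_sub D₁ p fun S₁ hS₁ => ?_
    rw [ED_congr_sub D₂ p (fun S₂ hS₂ => h S₁ S₂ hS₁ hS₂)]
    rw [show (fun S₂ => ind A S₁ * ind B S₂ + ind A' S₁ * ind B' S₂ + ind A'' S₁ * ind B'' S₂) =
        fun S₂ => (ind A S₁ * ind B S₂ + ind A' S₁ * ind B' S₂) + ind A'' S₁ * ind B'' S₂ from rfl]
    rw [ED_add, ED_add, ED_mul_left, ED_mul_left, ED_mul_left]
    ring
  rw [h1, ED_add, ED_add, ED_mul_left, ED_mul_left, ED_mul_left]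
  ring

end Summation

end TerminalGluing

end Summit.CriticalPhenomena.PercolationContinuityZ3.Theorems
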